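import Mathlib
import Summits.PneNP.PneNP.Theorems.PstarGapLemma
import Summits.PneNP.PneNP.Theorems.PstarSAClosure
import Summits.PneNP.PneNP.Theorems.PstarGapPeeling
import Summits.PneNP.PneNP.Theorems.PstarGapSupport

/-!
# Elimination lemmas for minimal infeasible sets relative to a parity system (ROUND-24 item T24.13)

FRONTIER range-avoidance ladder (cell `pnp-ideate`, ROUND-24 gap-lemma programme `PstarGapLemma`, item T24.13 as re-scoped by the
planner seat p3 at 04:21Z; restricted-model combinatorics — nothing here bears on `P` versus `NP`).

The two `W`-relative elimination rules behind memo §13 R9 (1)–(3) / R10, for a pure `P⋆` instance `I`, a parity system `W` with total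
support `PstarGapSupport.wsupp W`, and a MINIMAL `W`-infeasible output set `J`:

* `xor_private_elim` (a): no output `j ∈ J` has an XOR slot that is `J`-private (read by no other output of `J`) and outside every
  constraint set of `W` — flip it (`PstarGapPeeling.eval_update_xor_slot`): the flip repairs `j`, moves no other output of `J` and no
  parity of `W`;
* `and_private_pair_elim` (b): no output `j ∈ J` has BOTH AND slots `J`-private and outside every constraint set of `W` — set the pair to
  `(c,c)` with `c = y_j ⊕ u₀ ⊕ u₁` (`PstarGapPeeling.eval_update_and_pair`);
* boundary forms `xor_bdry_mem_wsupp` / `and_bdry_mem_wsupp` (a `J`-boundary variable is `J`-private), and the `#W = 1` corollaries (d)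
  `xor_private_mem` / `and_private_mem`: with `W = {(C, b)}`, every `J`-private XOR slot lies in `C` and every output whose two AND slots
  are `J`-private has one of them in `C`.

The `#W = 0` case of the crux is `PstarGapPeeling.eq_empty_of_minInfeasible_empty` (T24.8a; not re-proved here), and the counting form
is `PstarGapSupport.card_le_two_mul_card_bdry_inter`.  No typedness, simple overlaps or degree bound is used.
-/

set_option linter.dupNamespace false -- `Summit.PneNP.PneNP.…`: summit = sub-problem name (D-0017 single-conjunct layout)

open Finset Literature.Computability.Complexity
open Summit.PneNP.PneNP.Theorems.PstarPDT (parity)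
open Summit.PneNP.PneNP.Theorems.PstarSALevel (varSet bdry)
open Summit.PneNP.PneNP.Theorems.PstarGapLemma (Sat Feasible MinInfeasible)
open Summit.PneNP.PneNP.Theorems.PstarGapPeeling (not_mem_varSet_of_private eval_update_of_not_mem eval_update_xor_slot
  eval_update_and_pair)
open Summit.PneNP.PneNP.Theorems.PstarGapSupport (wsupp mem_wsupp sat_update_of_notMem)

namespace Summit.PneNP.PneNP.Theorems.PstarMinInfeasibleElim

variable {n m : ℕ}

/-- Outside every constraint set means outside the total support. -/
theorem not_mem_wsupp_of_forall {W : Finset (Finset (Fin n) × Bool)} {v : Fin n} (h : ∀ cb ∈ W, v ∉ cb.1) : v ∉ wsupp W :=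
  fun hv => by
    obtain ⟨cb, hcb, hv'⟩ := mem_wsupp.1 hv
    exact h cb hcb hv'

/-! ## (a) A private XOR slot outside the supports is eliminable -/

/-- **(a) XOR elimination.**  In a minimal `W`-infeasible set no output has a `J`-private XOR slot outside every constraint set of `W`. -/
theorem xor_private_elim (I : LocalMap 4 n m) (hI : I.IsPure xorAndPred) {y : Fin m → Bool} {W : Finset (Finset (Fin n) × Bool)}
    {J : Finset (Fin m)} (hmin : MinInfeasible I y W J) {j : Fin m} (hj : j ∈ J) (s : Fin 4) (hs : s.val < 2)
    (hpriv : ∀ j' ∈ J, j' ≠ j → I.vars j s ∉ varSet I j') (hW : ∀ cb ∈ W, I.vars j s ∉ cb.1) : False := by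
  classical
  obtain ⟨z₀, hW₀, hz₀⟩ := hmin.2 j hj
  apply hmin.1
  by_cases hok : I.eval z₀ j = y j
  · exact ⟨z₀, hW₀, fun j' hj' => if h : j' = j then by rw [h]; exact hok else hz₀ j' (mem_erase.2 ⟨h, hj'⟩)⟩
  refine ⟨Function.update z₀ (I.vars j s) (!z₀ (I.vars j s)), sat_update_of_notMem (not_mem_wsupp_of_forall hW) hW₀ _,
    fun j' hj' => ?_⟩
  by_cases h : j' = j
  · subst h
    rw [eval_update_xor_slot I hI z₀ j' s hs]
    revert hok
    cases I.eval z₀ j' <;> cases y j' <;> simp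
  · rw [eval_update_of_not_mem I j' z₀ (hpriv j' hj' h)]
    exact hz₀ j' (mem_erase.2 ⟨h, hj'⟩)

/-- (a), boundary form: a `J`-boundary XOR slot of an output of a minimal `W`-infeasible `J` lies in the total support of `W`. -/
theorem xor_bdry_mem_wsupp (I : LocalMap 4 n m) (hI : I.IsPure xorAndPred) {y : Fin m → Bool} {W : Finset (Finset (Fin n) × Bool)}
    {J : Finset (Fin m)} (hmin : MinInfeasible I y W J) {j : Fin m} (hj : j ∈ J) (s : Fin 4) (hs : s.val < 2)
    (hb : I.vars j s ∈ bdry I J) : I.vars j s ∈ wsupp W := by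
  by_contra hW
  refine xor_private_elim I hI hmin hj s hs (fun j' hj' hne => ?_) (fun cb hcb hv => hW (mem_wsupp.2 ⟨cb, hcb, hv⟩))
  exact not_mem_varSet_of_private I hj hj' hne hb (mem_image.2 ⟨s, mem_univ _, rfl⟩)

/-! ## (b) A private AND pair outside the supports is eliminable -/

/-- **(b) AND-pair elimination.**  In a minimal `W`-infeasible set no output has both AND slots `J`-private and outside every constraint
set of `W`. -/
theorem and_private_pair_elim (I : LocalMap 4 n m) (hI : I.IsPure xorAndPred) {y : Fin m → Bool}
    {W : Finset (Finset (Fin n) × Bool)} {J : Finset (Fin m)} (hmin : MinInfeasible I y W J) {j : Fin m} (hj : j ∈ J)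
    (hp : ∀ j' ∈ J, j' ≠ j → I.vars j 2 ∉ varSet I j') (hq : ∀ j' ∈ J, j' ≠ j → I.vars j 3 ∉ varSet I j')
    (hWp : ∀ cb ∈ W, I.vars j 2 ∉ cb.1) (hWq : ∀ cb ∈ W, I.vars j 3 ∉ cb.1) : False := by
  classical
  obtain ⟨z₀, hW₀, hz₀⟩ := hmin.2 j hj
  apply hmin.1
  set c := xor (xor (z₀ (I.vars j 0)) (z₀ (I.vars j 1))) (y j) with hc
  refine ⟨Function.update (Function.update z₀ (I.vars j 2) c) (I.vars j 3) c,
    sat_update_of_notMem (not_mem_wsupp_of_forall hWq) (sat_update_of_notMem (not_mem_wsupp_of_forall hWp) hW₀ _) _,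
    fun j' hj' => ?_⟩
  by_cases h : j' = j
  · subst h
    rw [eval_update_and_pair I hI z₀ j' c, hc]
    cases z₀ (I.vars j' 0) <;> cases z₀ (I.vars j' 1) <;> cases y j' <;> rfl
  · rw [eval_update_of_not_mem I j' _ (hq j' hj' h), eval_update_of_not_mem I j' _ (hp j' hj' h)]
    exact hz₀ j' (mem_erase.2 ⟨h, hj'⟩)

/-- (b), boundary form: if both AND slots of an output of a minimal `W`-infeasible `J` are `J`-boundary variables, one of them lies in
the total support of `W`. -/
theorem and_bdry_mem_wsupp (I : LocalMap 4 n m) (hI : I.IsPure xorAndPred) {y : Fin m → Bool} {W : Finset (Finset (Fin n) × Bool)}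
    {J : Finset (Fin m)} (hmin : MinInfeasible I y W J) {j : Fin m} (hj : j ∈ J) (h2 : I.vars j 2 ∈ bdry I J)
    (h3 : I.vars j 3 ∈ bdry I J) : I.vars j 2 ∈ wsupp W ∨ I.vars j 3 ∈ wsupp W := by
  by_contra hW
  push Not at hW
  refine and_private_pair_elim I hI hmin hj (fun j' hj' hne => ?_) (fun j' hj' hne => ?_)
    (fun cb hcb hv => hW.1 (mem_wsupp.2 ⟨cb, hcb, hv⟩)) (fun cb hcb hv => hW.2 (mem_wsupp.2 ⟨cb, hcb, hv⟩))
  · exact not_mem_varSet_of_private I hj hj' hne h2 (mem_image.2 ⟨2, mem_univ _, rfl⟩)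
  · exact not_mem_varSet_of_private I hj hj' hne h3 (mem_image.2 ⟨3, mem_univ _, rfl⟩)

/-! ## (d) One parity constraint -/

/-- The total support of a single constraint is its set. -/
theorem wsupp_singleton (C : Finset (Fin n)) (b : Bool) : wsupp ({(C, b)} : Finset (Finset (Fin n) × Bool)) = C := by
  unfold PstarGapSupport.wsupp
  rw [singleton_biUnion]

/-- **(d, XOR)**: under one parity constraint `(C, b)`, every `J`-boundary XOR slot of a minimal infeasible `J` lies in `C`. -/
theorem xor_private_mem (I : LocalMap 4 n m) (hI : I.IsPure xorAndPred) {y : Fin m → Bool} {C : Finset (Fin n)} {b : Bool}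
    {J : Finset (Fin m)} (hmin : MinInfeasible I y {(C, b)} J) {j : Fin m} (hj : j ∈ J) (s : Fin 4) (hs : s.val < 2)
    (hb : I.vars j s ∈ bdry I J) : I.vars j s ∈ C := by
  have h := xor_bdry_mem_wsupp I hI hmin hj s hs hb
  rwa [wsupp_singleton] at h

/-- **(d, AND)**: under one parity constraint `(C, b)`, every output of a minimal infeasible `J` whose two AND slots are `J`-boundary
variables has one of them in `C`. -/
theorem and_private_mem (I : LocalMap 4 n m) (hI : I.IsPure xorAndPred) {y : Fin m → Bool} {C : Finset (Fin n)} {b : Bool}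
    {J : Finset (Fin m)} (hmin : MinInfeasible I y {(C, b)} J) {j : Fin m} (hj : j ∈ J) (h2 : I.vars j 2 ∈ bdry I J)
    (h3 : I.vars j 3 ∈ bdry I J) : I.vars j 2 ∈ C ∨ I.vars j 3 ∈ C := by
  have h := and_bdry_mem_wsupp I hI hmin hj h2 h3
  rwa [wsupp_singleton] at h

/-- (d, counting): under one parity constraint of support `C`, a minimal infeasible set of at most `r` outputs of a pure
`(r, 3/2)`-expanding instance has `|J| ≤ 2·|bdry J ∩ C| ≤ 2·|C|` (`PstarGapSupport`). -/
theorem card_le_two_mul_of_one (I : LocalMap 4 n m) (hI : I.IsPure xorAndPred) {r : ℕ}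
    (hB : PstarSALevel.BoundaryExpanding r I) {y : Fin m → Bool} {C : Finset (Fin n)} {b : Bool} {J : Finset (Fin m)}
    (hJr : J.card ≤ r) (hmin : MinInfeasible I y {(C, b)} J) : J.card ≤ 2 * (bdry I J ∩ C).card := by
  have h := PstarGapSupport.card_le_two_mul_card_bdry_inter I hI hB hJr hmin
  rwa [wsupp_singleton] at h

end Summit.PneNP.PneNP.Theorems.PstarMinInfeasibleElim
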